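import Mathlib
import Literature.MathematicalPhysics.StatisticalMechanics.BarlowStacking
import Literature.MathematicalPhysics.StatisticalMechanics.HaggStacking

/-!
# First shell of a flexible-gap Barlow pattern, part A: coordinates, norm form, integer lemmas

Support lemmas (lens-3, `ChartedPlanarOrder.ChartedZeroExcessLayered`, helper lines V/T, K and
C-prep Tc): the admissible patterns of the crux (`A (i u_b + j v_b + (haggLabel s m) w_b + z m e₃)`,
scale `b ∈ [9/10, 1]`, Hägg sequence `s`, free interlayer gaps `z (m+1) - z m ∈ [39b/50, 17b/20]`,
`z 0 = 0`) are exactly 12-coordinated at the bond threshold `28/25`. Part A: the coordinates and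
the norm form `‖p‖² = b² (i² + ij + j² + L (i+j) + L²/3) + (z m)²` of a pattern point, the labels
and heights of the layers `m = ±1`, `|m| ≥ 2`, and the integer solution sets of the in-plane forms.
-/

namespace Summit.AtomisticToContinuum.Crystallization.Theorems.ChartedPlanarOrderPatternFirstShellA

open Literature.MathematicalPhysics.StatisticalMechanics

/-! ### Coordinates and norm of a pattern point -/

/-- First coordinate of the pattern point `(m, i, j)`. -/
theorem patPos_apply_zero (b : ℝ) (s : ℤ → ℤ) (z : ℤ → ℝ) (m i j : ℤ) :
    ((i : ℝ) • triangularVec₁ b + (j : ℝ) • triangularVec₂ b + (haggLabel s m : ℝ) • barlowOffset b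
      + z m • layerNormal 1) 0 = b * (i + j / 2 + haggLabel s m / 2) := by
  simp [triangularVec₁, triangularVec₂, barlowOffset, layerNormal]; ring

/-- Second coordinate of the pattern point `(m, i, j)`. -/
theorem patPos_apply_one (b : ℝ) (s : ℤ → ℤ) (z : ℤ → ℝ) (m i j : ℤ) :
    ((i : ℝ) • triangularVec₁ b + (j : ℝ) • triangularVec₂ b + (haggLabel s m : ℝ) • barlowOffset b
      + z m • layerNormal 1) 1 = b * √3 / 2 * (j + haggLabel s m / 3) := by
  simp [triangularVec₁, triangularVec₂, barlowOffset, layerNormal]; ring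

/-- Third coordinate of the pattern point `(m, i, j)`: the free height `z m`. -/
theorem patPos_apply_two (b : ℝ) (s : ℤ → ℤ) (z : ℤ → ℝ) (m i j : ℤ) :
    ((i : ℝ) • triangularVec₁ b + (j : ℝ) • triangularVec₂ b + (haggLabel s m : ℝ) • barlowOffset b
      + z m • layerNormal 1) 2 = z m := by
  simp [triangularVec₁, triangularVec₂, barlowOffset, layerNormal]

/-- NORM FORM: `‖p‖² = b² (i² + ij + j² + L (i + j) + L²/3) + (z m)²`, `L = haggLabel s m`. -/
theorem norm_patPos_sq (b : ℝ) (s : ℤ → ℤ) (z : ℤ → ℝ) (m i j : ℤ) :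
    ‖(i : ℝ) • triangularVec₁ b + (j : ℝ) • triangularVec₂ b + (haggLabel s m : ℝ) • barlowOffset b
      + z m • layerNormal 1‖ ^ 2
      = b ^ 2 * ((i : ℝ) ^ 2 + i * j + (j : ℝ) ^ 2 + haggLabel s m * (i + j) + (haggLabel s m : ℝ) ^ 2 / 3)
        + (z m) ^ 2 := by
  rw [EuclideanSpace.norm_sq_eq, Fin.sum_univ_three, Real.norm_eq_abs, Real.norm_eq_abs,
    Real.norm_eq_abs, sq_abs, sq_abs, sq_abs, patPos_apply_zero, patPos_apply_one, patPos_apply_two]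
  have h3 : (√3 : ℝ) ^ 2 = 3 := Real.sq_sqrt (by norm_num)
  linear_combination (b ^ 2 * ((j : ℝ) + haggLabel s m / 3) ^ 2 / 4) * h3

/-! ### Labels and heights of the layers near the root -/

/-- The label of layer `1` is `s 0 = ±1` (from the landed recursion `haggLabel_succ`). -/
theorem haggLabel_one_cases (s : ℤ → ℤ) (hs : IsHaggSeq s) :
    haggLabel s 1 = 1 ∨ haggLabel s 1 = -1 := by
  have h := haggLabel_succ s 0
  simp only [zero_add, haggLabel_zero] at h
  rw [h]; exact hs 0

/-- The label of layer `-1` is `-s (-1) = ±1`. -/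
theorem haggLabel_neg_one_cases (s : ℤ → ℤ) (hs : IsHaggSeq s) :
    haggLabel s (-1) = 1 ∨ haggLabel s (-1) = -1 := by
  have h := haggLabel_succ s (-1)
  simp only [neg_add_cancel, haggLabel_zero] at h
  rcases hs (-1) with h1 | h1 <;> [right; left] <;> linarith

/-- Heights: `z 1 ∈ [39b/50, 17b/20]`, `z (-1) ∈ [-17b/20, -39b/50]`, and `|z m| ≥ 2 · 39b/50`
for `|m| ≥ 2`. -/
theorem heights (b : ℝ) (hb : 0 ≤ b) (z : ℤ → ℝ)
    (hz : ∀ m : ℤ, 39 / 50 * b ≤ z (m + 1) - z m ∧ z (m + 1) - z m ≤ 17 / 20 * b) (hz0 : z 0 = 0) :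
    (39 / 50 * b ≤ z 1 ∧ z 1 ≤ 17 / 20 * b) ∧ (-(17 / 20 * b) ≤ z (-1) ∧ z (-1) ≤ -(39 / 50 * b)) ∧
      ∀ m : ℤ, m ≠ 0 → m ≠ 1 → m ≠ -1 → 2 * (39 / 50 * b) ≤ |z m| := by
  have h1 := hz 0
  have h2 := hz (-1)
  simp only [zero_add, hz0, sub_zero, neg_add_cancel, zero_sub] at h1 h2
  refine ⟨h1, ⟨by linarith [h2.2], by linarith [h2.1]⟩, ?_⟩
  -- linear growth in both directions
  have hup : ∀ n : ℕ, (n : ℝ) * (39 / 50 * b) ≤ z n := by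
    intro n
    induction n with
    | zero => simp [hz0]
    | succ n ih => have := hz n; push_cast; linarith [this.1]
  have hdn : ∀ n : ℕ, z (-(n : ℤ)) ≤ -((n : ℝ) * (39 / 50 * b)) := by
    intro n
    induction n with
    | zero => simp [hz0]
    | succ n ih =>
      have h' := hz (-((n + 1 : ℕ) : ℤ))
      rw [show (-((n + 1 : ℕ) : ℤ) + 1) = -(n : ℤ) by push_cast; ring] at h'
      push_cast at h' ⊢; linarith [h'.1]
  intro m hm0 hm1 hm2
  rcases le_or_gt 0 m with h0 | h0
  · obtain ⟨n, rfl⟩ : ∃ n : ℕ, m = n := ⟨m.toNat, by omega⟩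
    have hn2 : (2 : ℝ) ≤ n := by exact_mod_cast (show 2 ≤ n by omega)
    have hzn := hup n
    have hpos : 0 ≤ z n := le_trans (by positivity) hzn
    rw [abs_of_nonneg hpos]
    nlinarith
  · obtain ⟨n, rfl⟩ : ∃ n : ℕ, m = -(n : ℤ) := ⟨(-m).toNat, by omega⟩
    have hn2 : (2 : ℝ) ≤ n := by exact_mod_cast (show 2 ≤ n by omega)
    have hzn := hdn n
    have hneg : z (-(n : ℤ)) ≤ 0 := le_trans hzn (by nlinarith)
    rw [abs_of_nonpos hneg]
    nlinarith

/-! ### Integer solution sets of the in-plane forms -/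

/-- `i² + ij + j² = 1` has exactly the six solutions `±(1,0), ±(0,1), ±(1,-1)`. -/
theorem form_eq_one_iff (i j : ℤ) :
    i ^ 2 + i * j + j ^ 2 = 1 ↔ (i, j) ∈ ({(1, 0), (-1, 0), (0, 1), (0, -1), (1, -1), (-1, 1)} :
      Finset (ℤ × ℤ)) := by
  constructor
  · intro h
    have hi : i ≤ 1 ∧ -1 ≤ i := by constructor <;> nlinarith [sq_nonneg (i + 2 * j), sq_nonneg (2 * i + j), sq_nonneg j]
    have hj : j ≤ 1 ∧ -1 ≤ j := by constructor <;> nlinarith [sq_nonneg (i + 2 * j), sq_nonneg (2 * i + j), sq_nonneg i]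
    obtain ⟨hi1, hi2⟩ := hi
    obtain ⟨hj1, hj2⟩ := hj
    interval_cases i <;> interval_cases j <;> simp_all (config := {decide := true})
  · intro h
    simp only [Finset.mem_insert, Finset.mem_singleton, Prod.mk.injEq] at h
    rcases h with ⟨rfl, rfl⟩ | ⟨rfl, rfl⟩ | ⟨rfl, rfl⟩ | ⟨rfl, rfl⟩ | ⟨rfl, rfl⟩ | ⟨rfl, rfl⟩ <;> norm_num

/-- `i² + ij + j² + (i + j) = 0` (the holes below a `+1`-shifted layer) has exactly the three
solutions `(0,0), (-1,0), (0,-1)`. -/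
theorem form_plus_eq_zero_iff (i j : ℤ) :
    i ^ 2 + i * j + j ^ 2 + (i + j) = 0 ↔ (i, j) ∈ ({(0, 0), (-1, 0), (0, -1)} : Finset (ℤ × ℤ)) := by
  constructor
  · intro h
    have hi : i ≤ 1 ∧ -2 ≤ i := by constructor <;> nlinarith [sq_nonneg (i + 2 * j + 1), sq_nonneg (2 * i + j + 1), sq_nonneg (i - j)]
    have hj : j ≤ 1 ∧ -2 ≤ j := by constructor <;> nlinarith [sq_nonneg (i + 2 * j + 1), sq_nonneg (2 * i + j + 1), sq_nonneg (i - j)]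
    obtain ⟨hi1, hi2⟩ := hi
    obtain ⟨hj1, hj2⟩ := hj
    interval_cases i <;> interval_cases j <;> simp_all (config := {decide := true})
  · intro h
    simp only [Finset.mem_insert, Finset.mem_singleton, Prod.mk.injEq] at h
    rcases h with ⟨rfl, rfl⟩ | ⟨rfl, rfl⟩ | ⟨rfl, rfl⟩ <;> norm_num

/-- `i² + ij + j² - (i + j) = 0` (the holes below a `-1`-shifted layer) has exactly the three
solutions `(0,0), (1,0), (0,1)`. -/
theorem form_minus_eq_zero_iff (i j : ℤ) :
    i ^ 2 + i * j + j ^ 2 - (i + j) = 0 ↔ (i, j) ∈ ({(0, 0), (1, 0), (0, 1)} : Finset (ℤ × ℤ)) := by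
  constructor
  · intro h
    have hi : i ≤ 2 ∧ -1 ≤ i := by constructor <;> nlinarith [sq_nonneg (i + 2 * j - 1), sq_nonneg (2 * i + j - 1), sq_nonneg (i - j)]
    have hj : j ≤ 2 ∧ -1 ≤ j := by constructor <;> nlinarith [sq_nonneg (i + 2 * j - 1), sq_nonneg (2 * i + j - 1), sq_nonneg (i - j)]
    obtain ⟨hi1, hi2⟩ := hi
    obtain ⟨hj1, hj2⟩ := hj
    interval_cases i <;> interval_cases j <;> simp_all (config := {decide := true})
  · intro h
    simp only [Finset.mem_insert, Finset.mem_singleton, Prod.mk.injEq] at h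
    rcases h with ⟨rfl, rfl⟩ | ⟨rfl, rfl⟩ | ⟨rfl, rfl⟩ <;> norm_num

/-- Nonnegativity of the in-plane forms: `i² + ij + j² ≥ 0` and `i² + ij + j² ± (i+j) ≥ 0`
(they are `‖i u + j v + L w‖²/b² - L²/3` with minimum `0`). -/
theorem forms_nonneg (i j : ℤ) :
    0 ≤ i ^ 2 + i * j + j ^ 2 ∧ 0 ≤ i ^ 2 + i * j + j ^ 2 + (i + j) ∧
      0 ≤ i ^ 2 + i * j + j ^ 2 - (i + j) := by
  refine ⟨by nlinarith [sq_nonneg (2 * i + j), sq_nonneg j], ?_, ?_⟩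
  · nlinarith [sq_nonneg (2 * i + j + 1), sq_nonneg (j + 1), sq_nonneg (i + j + 1), sq_nonneg (i - j)]
  · nlinarith [sq_nonneg (2 * i + j - 1), sq_nonneg (j - 1), sq_nonneg (i + j - 1), sq_nonneg (i - j)]

end Summit.AtomisticToContinuum.Crystallization.Theorems.ChartedPlanarOrderPatternFirstShellA
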